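import Mathlib
import Summits.ValiantsHypothesis.ValiantsHypothesis.Theorems.BarrierLeverPartitionMinorsHitByVPHiddenStatesSymbolicStep
import Summits.ValiantsHypothesis.ValiantsHypothesis.Theorems.BarrierLeverPartitionMinorsHitByVPHiddenStatesCoordEmbed
import Summits.ValiantsHypothesis.ValiantsHypothesis.Theorems.BarrierLeverPartitionMinorsHitByVPHiddenStatesFullJoinLeaf
import Summits.ValiantsHypothesis.ValiantsHypothesis.Theorems.BarrierLeverPartitionMinorsHitByVPHiddenStatesFullJoinPrep

/-!
# Route BarrierLever — item `PartitionMinorsHitByVP` (stmt-ValiantsHypothesis-19717), line `hidden-states`: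
# THE EXACT COORDINATE CUT FOR THE BALL DESIGN, 0 — preparations (state renaming, rigidity, the zeta leaf)

Helper file (`--supports stmt-ValiantsHypothesis-19717`; cell valiant-natproofs, 𝒟-side door (c), registered line
`Cruxes/PartitionMinorsHitByVP/Lines/hidden_states.lean` v9; prover seat val-np-p6 gen 21).  Closes NO item; definition-free.

THE POINT (memo HOME/val-np-p6/g21/MEMO-valnp6-g21.md §1).  The m-th-shell column studies the families `𝒰 = B_t ∖ {A_l} ∪ {C_l}`
against the ball `B_t` with one cube of `K = h` states.  The siblings `…BallCutFree` / `…BallCutBalanced` cut such a configuration at a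
coordinate `x` EXACTLY (both blocks square) using val-np-p3 g10's symbolic split theorem `SymbJoin.symGood_of_split_enum`; this file holds
the bookkeeping they share:
* `symDet_map_stateEmbedding` / `symGood_map_stateEmbedding` — generic goodness is invariant under renaming the STATES along an
  embedding (the coordinate version is val-np-p6 g8's `SymbJoin.symGood_map_embedding`);
* `exists_table_iff_symGood` — the column's numeric form `∃ tx : Option (Fin h) → Fin h → ℂ, det ≠ 0` is `symDet u (0, cols) ≠ 0`;
* `card_shellFamily` — `|B_t(S) ∖ {A_l} ∪ {C_l}| = |B_t(S)|`;
* `rigidity` — under the standard hypotheses of every theorem of the column (`u` injective in the family, `cols` covering the ball)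
  `cols` is injective onto the ball and `u` is onto the family (so `r = |B_t(h)|`);
* `symGood_leaf_erase` — THE ZETA LEAF: if every column contains the state `x` and the rows are the columns with `x` erased, the
  configuration is generically good (the table reading each coordinate `a ≠ x` through its own state makes the matrix a column
  permutation of the inclusion matrix of the rows, a unit by `FullJoin.inclusionMatrix_isUnit`).

HONEST LABEL: conjecture-column toolkit (m-th shell of the ball, every `m, t, h`); 19717 stays OPEN; nothing on crux 14610 or VP ≠ VNP.
-/

set_option linter.dupNamespace false

namespace Summit.ValiantsHypothesis.ValiantsHypothesis.Theorems.BarrierLever.HiddenStates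

open Finset

noncomputable section

namespace BallCut

open SymbJoin

variable {h : ℕ}

/-! ## 1. Renaming states, and the one-piece symbolic form -/

/-- Renaming the STATE index of the table indeterminates along `ρ`. -/
theorem rename_symPoint_state {n m K r : ℕ} (ρ : Fin n ↪ Fin K) (e : Fin r → Fin m × Finset (Fin n)) (k : Fin r) (a : Fin h) :
    MvPolynomial.rename (fun v : Var m n h => ((v.1, v.2.1.map ρ, v.2.2) : Var m K h)) (symPoint e k a)
      = symPoint (h := h) (fun k => ((e k).1, (e k).2.map ρ)) k a := by
  simp [symPoint, map_add, map_sum, MvPolynomial.rename_X, Finset.sum_map]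

/-- **The symbolic determinant under a state embedding** is the renamed symbolic determinant. -/
theorem symDet_map_stateEmbedding {n m K r : ℕ} (ρ : Fin n ↪ Fin K) (u : Fin r → Finset (Fin h))
    (e : Fin r → Fin m × Finset (Fin n)) :
    symDet u (fun k => ((e k).1, (e k).2.map ρ))
      = MvPolynomial.rename (fun v : Var m n h => ((v.1, v.2.1.map ρ, v.2.2) : Var m K h)) (symDet u e) := by
  set f : Var m n h → Var m K h := fun v => (v.1, v.2.1.map ρ, v.2.2) with hf
  rw [symDet, symDet, show (MvPolynomial.rename f) (symMat u e).det
      = (MvPolynomial.rename f).toRingHom (symMat u e).det from rfl, RingHom.map_det]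
  congr 1
  apply Matrix.ext
  intro i k
  rw [RingHom.mapMatrix_apply, Matrix.map_apply]
  change ∏ a ∈ u i, symPoint (fun k => ((e k).1, (e k).2.map ρ)) k a = (MvPolynomial.rename f) (∏ a ∈ u i, symPoint e k a)
  rw [map_prod]
  exact Finset.prod_congr rfl fun a _ => (rename_symPoint_state ρ e k a).symm

/-- **Goodness transfers along state embeddings.** -/
theorem symGood_map_stateEmbedding {n m K r : ℕ} (ρ : Fin n ↪ Fin K) (u : Fin r → Finset (Fin h))
    (e : Fin r → Fin m × Finset (Fin n)) (hG : symDet u e ≠ 0) :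
    symDet u (fun k => ((e k).1, (e k).2.map ρ)) ≠ 0 := by
  rw [symDet_map_stateEmbedding]
  intro h0
  apply hG
  have hinj : Function.Injective (fun v : Var m n h => ((v.1, v.2.1.map ρ, v.2.2) : Var m K h)) := by
    rintro ⟨p, o, a⟩ ⟨p', o', a'⟩ hv
    simp only [Prod.mk.injEq] at hv
    obtain ⟨rfl, ho, rfl⟩ := hv
    rw [Option.map_injective ρ.injective ho]
  exact (MvPolynomial.rename_injective _ hinj) (by rw [h0, map_zero])

/-- One cube of `K = h` states: the numeric `∃ tx` form of the column is the symbolic goodness of the one-piece configuration. -/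
theorem exists_table_iff_symGood {r : ℕ} (u cols : Fin r → Finset (Fin h)) :
    (∃ tx : Option (Fin h) → Fin h → ℂ,
        (Matrix.of fun i k : Fin r => ∏ a ∈ u i, (tx none a + ∑ q ∈ cols k, tx (some q) a)).det ≠ 0)
      ↔ symDet u (fun k => ((0 : Fin 1), cols k)) ≠ 0 := by
  rw [symGood_iff_exists_table]
  constructor
  · rintro ⟨tx, htx⟩
    exact ⟨fun _ => tx, by simpa using htx⟩
  · rintro ⟨tx, htx⟩
    exact ⟨tx 0, by simpa using htx⟩

/-! ## 2. Counting: the m-th-shell family has the size of the ball -/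

/-- `|B_t(S) ∖ {A_l} ∪ {C_l}| = |B_t(S)|` when the `A_l ⊆ S` are `m` distinct `t`-sets and the `C_l` are `m` distinct `(t+1)`-sets. -/
theorem card_shellFamily (t : ℕ) {m : ℕ} (S : Finset (Fin h)) (A C : Fin m → Finset (Fin h))
    (hA : ∀ l, (A l).card = t) (hC : ∀ l, (C l).card = t + 1)
    (hAi : Function.Injective A) (hCi : Function.Injective C) (hAS : ∀ l, A l ⊆ S) :
    (((S.powerset.filter fun J => J.card ≤ t) \ Finset.univ.image A) ∪ Finset.univ.image C).card
      = (S.powerset.filter fun J => J.card ≤ t).card := by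
  classical
  set B := S.powerset.filter fun J => J.card ≤ t with hB
  have hAB : Finset.univ.image A ⊆ B := by
    intro U hU
    obtain ⟨l, -, rfl⟩ := Finset.mem_image.1 hU
    rw [hB, Finset.mem_filter, Finset.mem_powerset]
    exact ⟨hAS l, (hA l).le⟩
  have hdisj : Disjoint (B \ Finset.univ.image A) (Finset.univ.image C) := by
    rw [Finset.disjoint_left]
    intro U hU hU'
    obtain ⟨l, -, rfl⟩ := Finset.mem_image.1 hU'
    have := (Finset.mem_filter.1 (Finset.mem_sdiff.1 hU).1).2
    rw [hC l] at this
    omega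
  rw [Finset.card_union_of_disjoint hdisj, Finset.card_sdiff_of_subset hAB,
    Finset.card_image_of_injective _ hAi, Finset.card_image_of_injective _ hCi, Finset.card_univ, Fintype.card_fin]
  have : m ≤ B.card := by
    have := Finset.card_le_card hAB
    rwa [Finset.card_image_of_injective _ hAi, Finset.card_univ, Fintype.card_fin] at this
  omega

/-! ## 3. Rigidity of the standard hypotheses -/

/-- **Rigidity.** Under the standard hypotheses (injective rows in the m-th-shell family, columns covering the ball) the columns are
injective and range exactly over the ball, and the rows range exactly over the family. -/
theorem rigidity (t : ℕ) {m : ℕ} (A C : Fin m → Finset (Fin h))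
    (hA : ∀ l, (A l).card = t) (hC : ∀ l, (C l).card = t + 1)
    (hAi : Function.Injective A) (hCi : Function.Injective C)
    {r : ℕ} (u cols : Fin r → Finset (Fin h)) (hu : Function.Injective u)
    (hU : ∀ i, ((u i).card ≤ t ∧ ∀ l, u i ≠ A l) ∨ ∃ l, u i = C l)
    (hcols : ∀ J : Finset (Fin h), J.card ≤ t → ∃ k, cols k = J) :
    Function.Injective cols ∧
      (∀ U, (∃ i, u i = U) ↔ ((U.card ≤ t ∧ ∀ l, U ≠ A l) ∨ ∃ l, U = C l)) ∧
      (∀ J, (∃ k, cols k = J) ↔ J.card ≤ t) := by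
  classical
  set B := (Finset.univ : Finset (Fin h)).powerset.filter fun J => J.card ≤ t with hB
  set 𝒰 := (B \ Finset.univ.image A) ∪ Finset.univ.image C with h𝒰
  have hmemB : ∀ J, J ∈ B ↔ J.card ≤ t := fun J => by simp [hB]
  have hmem𝒰 : ∀ U, U ∈ 𝒰 ↔ ((U.card ≤ t ∧ ∀ l, U ≠ A l) ∨ ∃ l, U = C l) := by
    intro U
    rw [h𝒰, Finset.mem_union, Finset.mem_sdiff, hmemB]
    simp only [Finset.mem_image, Finset.mem_univ, true_and, not_exists]
    constructor
    · rintro (⟨h1, h2⟩ | ⟨l, hl⟩)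
      · exact Or.inl ⟨h1, fun l hl => h2 l hl.symm⟩
      · exact Or.inr ⟨l, hl.symm⟩
    · rintro (⟨h1, h2⟩ | ⟨l, hl⟩)
      · exact Or.inl ⟨h1, fun l hl => h2 l hl.symm⟩
      · exact Or.inr ⟨l, hl.symm⟩
  have hcard : 𝒰.card = B.card :=
    card_shellFamily t Finset.univ A C hA hC hAi hCi fun l => Finset.subset_univ _
  -- `u` maps into `𝒰`
  have hu𝒰 : Finset.univ.image u ⊆ 𝒰 := by
    intro U hU'
    obtain ⟨i, -, rfl⟩ := Finset.mem_image.1 hU'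
    exact (hmem𝒰 _).2 (hU i)
  have hr1 : r ≤ 𝒰.card := by
    have := Finset.card_le_card hu𝒰
    rwa [Finset.card_image_of_injective _ hu, Finset.card_univ, Fintype.card_fin] at this
  -- a choice of column index for every ball set
  have hch : ∀ J : B, ∃ k, cols k = J.1 := fun J => hcols J.1 ((hmemB _).1 J.2)
  choose kf hkf using hch
  have hkf_inj : Function.Injective kf := by
    intro J J' hJJ'
    apply Subtype.ext
    rw [← hkf J, ← hkf J', hJJ']
  have hr2 : B.card ≤ r := by
    have := Fintype.card_le_of_injective kf hkf_inj
    rwa [Fintype.card_coe, Fintype.card_fin] at this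
  have hr : r = B.card := le_antisymm (hcard ▸ hr1) hr2
  -- surjectivity of `u` onto `𝒰`
  have himu : Finset.univ.image u = 𝒰 := by
    apply Finset.eq_of_subset_of_card_le hu𝒰
    rw [Finset.card_image_of_injective _ hu, Finset.card_univ, Fintype.card_fin, hcard, ← hr]
  -- bijectivity of `kf`
  have hkf_bij : Function.Bijective kf := by
    rw [Fintype.bijective_iff_injective_and_card]
    exact ⟨hkf_inj, by rw [Fintype.card_coe, Fintype.card_fin, hr]⟩
  have hcols_mem : ∀ k, cols k ∈ B := by
    intro k
    obtain ⟨J, rfl⟩ := hkf_bij.2 k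
    rw [hkf J]; exact J.2
  refine ⟨?_, ?_, ?_⟩
  · intro k₁ k₂ hk
    obtain ⟨J₁, rfl⟩ := hkf_bij.2 k₁
    obtain ⟨J₂, rfl⟩ := hkf_bij.2 k₂
    rw [hkf J₁, hkf J₂] at hk
    rw [Subtype.ext hk]
  · intro U
    rw [← hmem𝒰, ← himu, Finset.mem_image]
    simp
  · intro J
    constructor
    · rintro ⟨k, rfl⟩; exact (hmemB _).1 (hcols_mem k)
    · exact hcols J

/-! ## 4. The leaf: rows = columns with one state erased (zeta table) -/

/-- **Leaf.** Columns `c j` all contain the state `x`; the rows are exactly the columns with `x` erased (in some order); then the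
one-piece configuration is generically good: the table reading every coordinate `a ≠ x` through its own state puts column `c j` at the
indicator of `(c j).erase x`, and the matrix is a column permutation of the inclusion matrix of the rows. -/
theorem symGood_leaf_erase {r₁ : ℕ} (x : Fin h) (v c : Fin r₁ → Finset (Fin h)) (hv : Function.Injective v)
    (hrange : ∀ U, (∃ j, v j = U) ↔ ∃ j, (c j).erase x = U) :
    symDet v (fun j => ((0 : Fin 1), c j)) ≠ 0 := by
  classical
  -- the rows are a permutation of the erased columns
  have hrange' : Set.range (fun j => (c j).erase x) = Set.range v := by
    ext U
    simp only [Set.mem_range]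
    exact (hrange U).symm
  obtain ⟨ρ, hρ⟩ := FullJoin.exists_perm_of_range_eq (fun j => (c j).erase x) v hv hrange'.symm
  -- hρ : ∀ j, v j = (c (ρ j)).erase x
  rw [← exists_table_iff_symGood]
  let tx : Option (Fin h) → Fin h → ℂ := fun o a =>
    match o with
    | none => 0
    | some q => if q = a then (if a = x then 0 else 1) else 0
  refine ⟨tx, ?_⟩
  have hpt : ∀ j a, tx none a + ∑ q ∈ c j, tx (some q) a = if a ∈ (c j).erase x then 1 else 0 := by
    intro j a
    simp only [tx, zero_add]
    rw [Finset.sum_ite_eq' (c j) a]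
    by_cases hax : a = x
    · subst hax; simp
    · by_cases ha : a ∈ c j
      · rw [if_pos ha, if_neg hax, if_pos (Finset.mem_erase.2 ⟨hax, ha⟩)]
      · rw [if_neg ha, if_neg (fun h' => ha (Finset.mem_of_mem_erase h'))]
  have hentry : ∀ i j, ∏ a ∈ v i, (tx none a + ∑ q ∈ c j, tx (some q) a)
      = if v i ⊆ (c j).erase x then 1 else 0 := by
    intro i j
    simp_rw [hpt j]
    rw [Finset.prod_boole]
    by_cases hs : v i ⊆ (c j).erase x
    · rw [if_pos hs, if_pos (fun a ha => hs ha)]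
    · rw [if_neg hs, if_neg (fun hall => hs (fun a ha => hall a ha))]
  set P : Matrix (Fin r₁) (Fin r₁) ℂ := Matrix.of fun i k => if v i ⊆ v k then (1 : ℂ) else 0 with hP
  have hPunit : IsUnit P := FullJoin.inclusionMatrix_isUnit v hv
  have hM : (Matrix.of fun i j : Fin r₁ => ∏ a ∈ v i, (tx none a + ∑ q ∈ c j, tx (some q) a))
      = P.submatrix id (ρ.symm : Fin r₁ → Fin r₁) := by
    ext i j
    rw [Matrix.of_apply, hentry, Matrix.submatrix_apply, hP, Matrix.of_apply, id, hρ (ρ.symm j), Equiv.apply_symm_apply]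
  rw [hM, Matrix.det_permute', mul_ne_zero_iff]
  refine ⟨?_, ?_⟩
  · rcases Int.units_eq_one_or (Equiv.Perm.sign ρ.symm) with h1 | h1 <;> simp [h1]
  · exact (Matrix.isUnit_iff_isUnit_det P |>.1 hPunit).ne_zero

end BallCut

end

end Summit.ValiantsHypothesis.ValiantsHypothesis.Theorems.BarrierLever.HiddenStates
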